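import Summits.QuantumFields.QCD.Theorems.SpectralDefectExtinctionWindowExtinctionSpreadR3Window
import Summits.QuantumFields.QCD.Theorems.SpectralDefectExtinctionWindowExtinctionSpreadLayerCake

/-!
# Stub `stub_spreadFromPartsR3` (S6′, the end-game of reshape r3) of line `free-volume-heavy-witness` —
INLINED form (crux `Summit.QuantumFields.QCD.Theses.SpectralDefectExtinction.WindowExtinction`, item
stmt-QuantumFields-8964)

`stub_spreadFromPartsR3_inlined` is the registered stub
`NegCountMeasurable → ImplantCostBound → DetQuasilocal → AntichainWeight → FiberAtomMonotone →
ActiveCoresAbundant → TemplatePair → ∀ Nf : ℕ, FixedCouplingIndexSpreadSub Nf`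
of the lead's r3 skeleton (`Cruxes/WindowExtinction/Lines/free_volume_heavy_witness_c2.lean`) with the
bodies of these `def … : Prop` (and of `negCount`, `deepIndex`, `absIndexMean`, `boxRestrict`,
`MonotonePair`, `tmplHaar`, `Tmpl`) unfolded, in tree vocabulary only, so that it is definitionally the
registered statement: in the skeleton, `theorem stub_spreadFromPartsR3 : … := stub_spreadFromPartsR3_inlined`.
(The sibling `…StubSpreadFromPartsR3.lean` restates the defs verbatim and proves the literal form this way.)

Proof (the route of the skeleton's `SpreadFromPartsR3` docstring, re-plumbed over the landed helpers
`…SpreadR3Pi / Fiber / Decomp / Arith / Cores / Atom / Window` and the previous lead's `…SpreadLayerCake /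
TorusBoxes / Telescope / Pattern`): `h₀ = 1/4`; at a window, the template pair gives `(R, Tp, Tm)`, the
one-box cost bound and quasi-locality their constants; `spreadR3_window` (odds floor, `C(ε₀)`, `m`, `N`,
`D`, separated centres, Markov property of the Wilson measure across separated boxes + quasi-locality ⇒
`e^{±τ}`-mixture fibres, fibre anti-concentration in monotone form, abundance of active cores) gives a torus
`2L'+1` on which every atom of the deep index `X_δ = n₋(Γ₅D_W(U,-δ,1)) - 6(2L'+1)⁴` (strictly monotone
under `Tm → Tp` swaps, measurable) has phase-quenched probability `≤ 1/4`; the layer cake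
(`spread_one_le_integral_abs_of_atom_le`) gives `E₊|X_δ| ≥ 1`.
-/

noncomputable section

namespace Summit.QuantumFields.QCD.Cruxes.WindowExtinction.FreeVolumeHeavyWitness

open scoped BigOperators Topology Classical ENNReal
open Filter MeasureTheory Matrix
open Literature.MathematicalPhysics.QuantumLattice Literature.MathematicalPhysics.QuantumFieldTheory
  Literature.Probability.LatticeModels

/-- The negative-eigenvalue count is at most the number of quark indices. -/
theorem spreadR3_negCount_le_card :
    ∀ {n : ℕ} [NeZero n] (U : GaugeConfig 4 n SU3) (m₀ : ℝ),
      (((spinorLift gammaFive * wilsonDirac (fundamentalRep (Fin 3)) U m₀ 1).charpoly.roots.countP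
          (fun z : ℂ => z.re < 0) : ℕ) : ℝ) ≤ Fintype.card (TorusSite 4 n × Fin 3 × Fin 4) := by
  intro n _ U m₀
  set M := spinorLift gammaFive * wilsonDirac (fundamentalRep (Fin 3)) U m₀ 1 with hM
  have h1 := Multiset.countP_le_card (fun z : ℂ => z.re < 0) M.charpoly.roots
  have h2 := Polynomial.card_roots' M.charpoly
  have h3 := Matrix.charpoly_natDegree_eq_dim M
  exact_mod_cast h1.trans (h2.trans h3.le)

/-- **STUB S6′, inlined form** (see the module docstring): the landed S1–S3, S4″ (with S4′), S5a and the
template pairs give the deep-subcritical fixed-coupling spread `C⁺_sub` for every `N_f` (with `h₀ = 1/4`). -/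
theorem stub_spreadFromPartsR3_inlined :
    (∀ (n : ℕ) [NeZero n] (m₀ : ℝ), Measurable fun U : GaugeConfig 4 n SU3 =>
       (spinorLift gammaFive * wilsonDirac (fundamentalRep (Fin 3)) U m₀ 1).charpoly.roots.countP
         fun z : ℂ => z.re < 0) →
    (∀ (Nf R : ℕ) (lo hi : ℝ), 0 < lo → lo ≤ hi → ∃ A B : ℝ,
       ∀ (n : ℕ) [NeZero n], 2 * R + 1 < n → ∀ (c : Fin 4 → ℤ) (μ : Fin Nf → ℝ),
         (∀ f, lo ≤ μ f ∧ μ f ≤ hi) → ∀ (U U' : GaugeConfig 4 n SU3),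
           (∀ e, (¬ ∃ y : ↥(box 4 R), Torus.proj n (c + (y : Fin 4 → ℤ)) = e.1) → U' e = U e) →
           |wilsonAction (fundamentalRep (Fin 3)) U' - wilsonAction (fundamentalRep (Fin 3)) U| ≤ A ∧
             |Real.log (∏ f : Fin Nf, ‖fermionDet (wilsonDirac (fundamentalRep (Fin 3)) U' (μ f) 1)‖) -
                 Real.log (∏ f : Fin Nf, ‖fermionDet (wilsonDirac (fundamentalRep (Fin 3)) U (μ f) 1)‖)| ≤ B) →
    (∀ (Nf R : ℕ) (lo hi : ℝ), 0 < lo → lo ≤ hi → ∃ C κ : ℝ, 0 < κ ∧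
       ∀ (n : ℕ) [NeZero n] (c₁ c₂ : Fin 4 → ℤ) (s : ℕ),
         (∀ q : Fin 4 → ℤ, ∃ j : Fin 4, ((2 * R + 1 + s : ℕ) : ℤ) ≤ |c₁ j - c₂ j - q j * n|) →
         ∀ (μ : Fin Nf → ℝ), (∀ f, lo ≤ μ f ∧ μ f ≤ hi) →
           ∀ (U U₁ U₂ U₁₂ : GaugeConfig 4 n SU3),
             (∀ e, (¬ ∃ y : ↥(box 4 R), Torus.proj n (c₁ + (y : Fin 4 → ℤ)) = e.1) → U₁ e = U e) →
             (∀ e, (¬ ∃ y : ↥(box 4 R), Torus.proj n (c₂ + (y : Fin 4 → ℤ)) = e.1) → U₂ e = U e) →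
             (∀ e, (∃ y : ↥(box 4 R), Torus.proj n (c₁ + (y : Fin 4 → ℤ)) = e.1) → U₁₂ e = U₁ e) →
             (∀ e, (¬ ∃ y : ↥(box 4 R), Torus.proj n (c₁ + (y : Fin 4 → ℤ)) = e.1) → U₁₂ e = U₂ e) →
             |Real.log (∏ f : Fin Nf, ‖fermionDet (wilsonDirac (fundamentalRep (Fin 3)) U₁₂ (μ f) 1)‖) -
                 Real.log (∏ f : Fin Nf, ‖fermionDet (wilsonDirac (fundamentalRep (Fin 3)) U₁ (μ f) 1)‖) -
                 Real.log (∏ f : Fin Nf, ‖fermionDet (wilsonDirac (fundamentalRep (Fin 3)) U₂ (μ f) 1)‖) +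
                 Real.log (∏ f : Fin Nf, ‖fermionDet (wilsonDirac (fundamentalRep (Fin 3)) U (μ f) 1)‖)| ≤
               C * Real.exp (-(κ * s))) →
    (∀ ε : ℝ, 0 < ε → ∃ C : ℝ, ∀ (N : ℕ) (p : Fin N → ℝ), (∀ i, ε ≤ p i ∧ p i ≤ 1 - ε) →
       ∀ 𝒜 : Finset (Fin N → Bool), (∀ s ∈ 𝒜, ∀ s' ∈ 𝒜, (∀ i, s i ≤ s' i) → s = s') →
         ∑ s ∈ 𝒜, ∏ i, (if s i then p i else 1 - p i) ≤ C / Real.sqrt (N + 1)) →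
    (∀ {I T : Type} [Fintype I] [DecidableEq I] [MeasurableSpace T]
       (ν : Measure T) [IsProbabilityMeasure ν] {Tp Tm : Set T},
       MeasurableSet Tp → MeasurableSet Tm → Disjoint Tp Tm → ν Tp ≠ 0 →
       ∀ {ε C : ℝ},
       (∀ (N : ℕ) (p : Fin N → ℝ), (∀ i, ε ≤ p i ∧ p i ≤ 1 - ε) →
         ∀ 𝒜 : Finset (Fin N → Bool), (∀ s ∈ 𝒜, ∀ s' ∈ 𝒜, (∀ i, s i ≤ s' i) → s = s') →
           ∑ s ∈ 𝒜, ∏ i, (if s i then p i else 1 - p i) ≤ C / Real.sqrt (N + 1)) →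
       ∀ {φ : (I → T) → ℝ}, Measurable φ → ∀ {a τ B : ℝ} {b : I → T → ℝ},
       (∀ i, Measurable (b i)) →
       (∀ t : I → T, (∀ i, t i ∈ Tp ∪ Tm) → |φ t - a - ∑ i, b i (t i)| ≤ τ) →
       (∀ i u u', u ∈ Tp ∪ Tm → u' ∈ Tp ∪ Tm → b i u ≤ b i u' + B) →
       (∀ i, ε * ∫ u in Tp ∪ Tm, Real.exp (b i u) ∂ν ≤ ∫ u in Tp, Real.exp (b i u) ∂ν ∧
         ∫ u in Tp, Real.exp (b i u) ∂ν ≤ (1 - ε) * ∫ u in Tp ∪ Tm, Real.exp (b i u) ∂ν) →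
       ∀ {X : (I → T) → ℤ}, Measurable X → ∀ (S' : Finset I),
       (∀ t : I → T, (∀ i, t i ∈ Tp ∪ Tm) → ∀ i ∈ S', ∀ u ∈ Tp, t i ∈ Tm →
         X t + 1 ≤ X (Function.update t i u)) →
       ∀ (j : ℤ),
       ∫⁻ t, (Set.pi Set.univ fun _ : I => Tp ∪ Tm).indicator
           (fun t => if X t = j then ENNReal.ofReal (Real.exp (φ t)) else 0) t
           ∂Measure.pi (fun _ : I => ν) ≤
         ENNReal.ofReal (Real.exp (2 * τ) * C / Real.sqrt (S'.card + 1)) *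
           ∫⁻ t, (Set.pi Set.univ fun _ : I => Tp ∪ Tm).indicator
             (fun t => ENNReal.ofReal (Real.exp (φ t))) t ∂Measure.pi (fun _ : I => ν)) →
    (∀ (Nf n R N m : ℕ) [NeZero n], 2 * R + 1 < n → ∀ (cs : Fin N → (Fin 4 → ℤ)),
       (∀ i j, i ≠ j → ∀ q : Fin 4 → ℤ, ∃ k : Fin 4, ((2 * R + 2 : ℕ) : ℤ) ≤ |cs i k - cs j k - q k * n|) →
       ∀ (β : ℝ) (μ : Fin Nf → ℝ), (∀ f, 0 < μ f) →
       ∀ (T : Set ((↥(box 4 R) × Fin 4) → SU3)), MeasurableSet T →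
       ∀ (Λ q : ℝ), 1 ≤ Λ → 0 < q →
         q ≤ ((Measure.pi fun _ : ↥(box 4 R) × Fin 4 => haarProbability SU3) T).toReal →
         (∀ (i : Fin N) (U U' : GaugeConfig 4 n SU3),
           (∀ e, (¬ ∃ y : ↥(box 4 R), Torus.proj n (cs i + (y : Fin 4 → ℤ)) = e.1) → U' e = U e) →
           Real.exp (-β * wilsonAction (fundamentalRep (Fin 3)) U') *
               ∏ f, ‖fermionDet (wilsonDirac (fundamentalRep (Fin 3)) U' (μ f) 1)‖ ≤
             Λ * (Real.exp (-β * wilsonAction (fundamentalRep (Fin 3)) U) *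
               ∏ f, ‖fermionDet (wilsonDirac (fundamentalRep (Fin 3)) U (μ f) 1)‖)) →
         qcdLatticeMeasure n β μ
             {U | (Finset.univ.filter fun i : Fin N =>
                 (fun yi : ↥(box 4 R) × Fin 4 => U (Torus.proj n (cs i + (yi.1 : Fin 4 → ℤ)), yi.2)) ∈ T).card
               < m} ≤
           ENNReal.ofReal ((N.choose (N - (m - 1)) : ℝ) * (1 - q / Λ ^ 2) ^ (N - (m - 1)))) →
    (∀ (Q : ℕ) (lo hi : ℝ), 0 < lo → lo ≤ hi → hi ≤ Q * lo → hi ≤ 1 / 4 →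
       ∃ (R : ℕ) (Tp Tm : Set ((↥(box 4 R) × Fin 4) → SU3)), MeasurableSet Tp ∧ MeasurableSet Tm ∧
         (Measure.pi fun _ : ↥(box 4 R) × Fin 4 => haarProbability SU3) Tp ≠ 0 ∧
         (Measure.pi fun _ : ↥(box 4 R) × Fin 4 => haarProbability SU3) Tm ≠ 0 ∧
         ∀ δ : ℝ, lo ≤ δ → δ ≤ hi →
           ∀ (n : ℕ) [NeZero n], 2 * R + 1 < n → ∀ (c : Fin 4 → ℤ) (U U' : GaugeConfig 4 n SU3),
             (∀ e, (¬ ∃ y : ↥(box 4 R), Torus.proj n (c + (y : Fin 4 → ℤ)) = e.1) → U' e = U e) →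
             (fun yi : ↥(box 4 R) × Fin 4 => U (Torus.proj n (c + (yi.1 : Fin 4 → ℤ)), yi.2)) ∈ Tm →
             (fun yi : ↥(box 4 R) × Fin 4 => U' (Torus.proj n (c + (yi.1 : Fin 4 → ℤ)), yi.2)) ∈ Tp →
             (spinorLift gammaFive * wilsonDirac (fundamentalRep (Fin 3)) U (-δ) 1).charpoly.roots.countP
                 (fun z : ℂ => z.re < 0) + 1 ≤
               (spinorLift gammaFive * wilsonDirac (fundamentalRep (Fin 3)) U' (-δ) 1).charpoly.roots.countP
                 (fun z : ℂ => z.re < 0)) →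
    ∀ Nf : ℕ,
    ∀ Q : ℕ, ∃ h₀ : ℝ, 0 < h₀ ∧ ∀ β lo hi : ℝ, 0 ≤ β → 0 < lo → lo ≤ hi → hi ≤ Q * lo → hi * max β 1 ≤ h₀ →
        ∀ L₀ : ℕ, ∃ L' : ℕ, L₀ ≤ L' ∧
          ∀ δ : ℝ, lo ≤ δ → δ ≤ hi → ∀ μ : Fin Nf → ℝ, (∀ f, lo ≤ μ f ∧ μ f ≤ hi) →
            1 ≤ qcdPhaseQuenchedExpect β (2 * L' + 1) μ fun U =>
              |((((spinorLift gammaFive * wilsonDirac (fundamentalRep (Fin 3)) U (-δ) 1).charpoly.roots.countP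
                  (fun z : ℂ => z.re < 0) : ℤ) - 6 * (2 * (L' : ℤ) + 1) ^ 4 : ℤ) : ℝ)| := by
  intro hNCM hICB hDQL hAW hFAM hACA hTP Nf Q
  refine ⟨1 / 4, by norm_num, ?_⟩
  intro β lo hi hβ hlo hlohi hQ hsub L₀
  have hhi4 : hi ≤ 1 / 4 := by
    have h1 : (1 : ℝ) ≤ max β 1 := le_max_right _ _
    have h0 : 0 ≤ hi := hlo.le.trans hlohi
    nlinarith
  obtain ⟨R, Tp, Tm, hTp, hTm, hTp0, hTm0, hMP⟩ := hTP Q lo hi hlo hlohi hQ hhi4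
  obtain ⟨A, B, hAB⟩ := hICB Nf R lo hi hlo hlohi
  obtain ⟨C₃, κ, hκ, hQL⟩ := hDQL Nf R lo hi hlo hlohi
  obtain ⟨L', hL₀, hRL, hwin⟩ :=
    spreadR3_window hFAM hACA hAW hTp hTm hTp0 hTm0 hβ hlo hlohi hκ hAB hQL L₀
  refine ⟨L', hL₀, fun δ hδ1 hδ2 μ hμ => ?_⟩
  have hμpos : ∀ f, 0 < μ f := fun f => hlo.trans_le (hμ f).1
  -- the deep index: measurable, bounded, strictly monotone under `Tm → Tp` swaps
  set cnt : GaugeConfig 4 (2 * L' + 1) SU3 → ℕ := fun U =>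
    (spinorLift gammaFive * wilsonDirac (fundamentalRep (Fin 3)) U (-δ) 1).charpoly.roots.countP
      (fun z : ℂ => z.re < 0) with hcnt
  set X : GaugeConfig 4 (2 * L' + 1) SU3 → ℤ := fun U => (cnt U : ℤ) - 6 * (2 * (L' : ℤ) + 1) ^ 4 with hX
  have hXm : Measurable X :=
    (measurable_from_top (f := fun k : ℕ => (k : ℤ) - 6 * (2 * (L' : ℤ) + 1) ^ 4)).comp
      (hNCM (2 * L' + 1) (-δ))
  have hmono : ∀ (c : Fin 4 → ℤ) (U U' : GaugeConfig 4 (2 * L' + 1) SU3),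
      (∀ e, (¬ ∃ y : ↥(box 4 R), Torus.proj (2 * L' + 1) (c + (y : Fin 4 → ℤ)) = e.1) → U' e = U e) →
      (fun yi : ↥(box 4 R) × Fin 4 => U (Torus.proj (2 * L' + 1) (c + (yi.1 : Fin 4 → ℤ)), yi.2)) ∈ Tm →
      (fun yi : ↥(box 4 R) × Fin 4 => U' (Torus.proj (2 * L' + 1) (c + (yi.1 : Fin 4 → ℤ)), yi.2)) ∈ Tp →
      X U + 1 ≤ X U' := by
    intro c U U' hagree hm hp
    have h := hMP δ hδ1 hδ2 (2 * L' + 1) hRL c U U' hagree hm hp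
    have h' : (cnt U : ℤ) + 1 ≤ cnt U' := by exact_mod_cast h
    simp only [hX]
    linarith
  have hatom : ∀ j : ℤ, qcdLatticeMeasure (2 * L' + 1) β μ
      {U : GaugeConfig 4 (2 * L' + 1) SU3 | X U = j} ≤ 4⁻¹ :=
    hwin μ hμ hXm hmono
  -- the phase-quenched measure is a probability measure (`det D_W(μ) ≠ 0` for `μ > 0`)
  have hdet : ∃ U₀ : GaugeConfig 4 (2 * L' + 1) SU3, (diracMatrix U₀ μ).det ≠ 0 := by
    refine ⟨fun _ => 1, ?_⟩
    rw [det_diracMatrix]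
    exact Finset.prod_ne_zero_iff.2 fun f _ =>
      wilsonDirac_det_ne_zero_of_pos (fundamentalRep (Fin 3)) (fun g => fundamentalRep_mem_unitaryGroup g)
        _ (hμpos f)
  haveI : IsProbabilityMeasure (qcdLatticeMeasure (2 * L' + 1) β μ) :=
    isProbabilityMeasure_qcdLatticeMeasure β μ (integral_norm_det_diracMatrix_pos_of_exists β μ hdet)
  -- integrability of the (bounded) index and the layer cake
  have hXr : Measurable fun U : GaugeConfig 4 (2 * L' + 1) SU3 => (X U : ℝ) :=
    (measurable_from_top (f := (Int.cast : ℤ → ℝ))).comp hXm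
  have hbound : ∀ U : GaugeConfig 4 (2 * L' + 1) SU3,
      |(X U : ℝ)| ≤ Fintype.card (TorusSite 4 (2 * L' + 1) × Fin 3 × Fin 4) + 6 * (2 * (L' : ℝ) + 1) ^ 4 := by
    intro U
    have hneg := spreadR3_negCount_le_card U (-δ)
    have h0 : (0 : ℝ) ≤ cnt U := Nat.cast_nonneg _
    have hc : (0 : ℝ) ≤ 6 * (2 * (L' : ℝ) + 1) ^ 4 := by positivity
    have hcast : (X U : ℝ) = (cnt U : ℝ) - 6 * (2 * (L' : ℝ) + 1) ^ 4 := by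
      simp only [hX]; push_cast; ring
    rw [hcast, abs_le]
    constructor <;> linarith
  have hint : Integrable (fun U : GaugeConfig 4 (2 * L' + 1) SU3 => (X U : ℝ))
      (qcdLatticeMeasure (2 * L' + 1) β μ) :=
    Integrable.of_bound hXr.aestronglyMeasurable _
      (Eventually.of_forall fun U => by rw [Real.norm_eq_abs]; exact hbound U)
  have h1 := spread_one_le_integral_abs_of_atom_le (qcdLatticeMeasure (2 * L' + 1) β μ) hXm hint hatom
  rw [qcdPhaseQuenchedExpect_eq_integral_qcdLatticeMeasure]
  exact h1

end Summit.QuantumFields.QCD.Cruxes.WindowExtinction.FreeVolumeHeavyWitness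

end
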